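import Summits.QuantumFields.BalabanUV.Beta.SymCorrectorLiteralW
import Summits.QuantumFields.BalabanUV.Beta.SymCorrectorSockets

/-!
# `BalabanUV.Beta.SymCorrectorLiteralLoc` — binder row D1, road «BF-x» junction (J1), brick TT9: LOCALISATION CERTIFICATES OF THE TRANSPORTED SECOND-ORDER WORDS
# (companion of TT8 `SymCorrectorLiteralW`; what `TameKernelCalculus.tadpole_add` ∕ `D1BFx/HessKerConjugation.hessKer_add_add_sub` need to split the literal's
# leg-dressed W word summand by summand; leaf-03 offer in LANDED-7, journal l.49736)

THE MATHEMATICS.  TT8 writes the literal's whole W slot at level 0 as `½ • (E μ y ν y′ + E ν y′ μ y)`, `E` = four words at the road's kernel `G₀`: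
the bi-vertex on the DOUBLY slot-transported pair table, two mixed bi-vertices on the slot-transported field–multiplier table, and the `dM ∘ K2` word
through the conjugated sandwich.  Each word is a LOCALISED kernel (`TameKernelCalculus.Loc`), hypothesis-free at the literal:
* §1 (generic `d`) the [S]-shape socket for field–multiplier tables: **`locStencilFM_slotPsiS`** — `LocStencilFM n M₂ C δ ⟹ LocStencilFM n (slotPsiS r n M₂)
  (C·(1 + faceWtSum·(d+1)·2n^{d+1}·e^{3δ(d+1)n})) δ` (TT5 `locStencil₂_slotPsiS_outer` with the coarse point `n•w` in place of the second fine bond);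
* §2 (generic) `loc_of_vertexFamily₂`; **`loc_dM_of_loc`** — `dM X n S M μ y` of a merely LOCALISED kernel `X` (an1's `biLoc_vertexOfK_of_biLoc` ∕
  `biLoc_vertexOfM_of_biLoc` after re-centring the second leg); `loc_mixOfK_of_spr` (an1's `vertexFamily₂_mixOfK`);
* §3 (generic, spread `K`, root `r ∈ box (d+1) n`) the four transported words: `loc_vertex2OfK_slot₂` (TT5 `locStencil₂_slotPsiS₂` + the OWNER's
  `loc_vertex2OfK_of_spr`), `loc_mixOfK_slot` (§1), **`loc_resp_slot`** (TT6 `loc_inner` + TT8 `loc_dM_of_spr` + `loc_dM_of_loc`), and `loc_transportedW`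
  (their sum `E μ y ν y′`);
* `legDress_half_add` — `Pᵀ∘(½•(A + B))∘P = ½•(Pᵀ∘A∘P + Pᵀ∘B∘P)` for spread `P`, localised `A`, `B` (tame bilinearity);
* §4 (d = 3, `n` odd) AT THE LITERAL: `loc_literalW_pair`, `loc_literalW_mix`, `loc_literalW_resp`, **`loc_literalW_transported`** — the words of TT8
  `JsB12CombSh0_W_zero_eq_transported` are localised, sockets discharged from the record's own letters; **`legDress_literalW`** — the literal's
  leg-dressed W word `Ψ̂ᵀ ∘ W⁰ μ y ν y′ ∘ Ψ̂ = ½ • (Ψ̂ᵀ∘E μ y ν y′∘Ψ̂ + Ψ̂ᵀ∘E ν y′ μ y∘Ψ̂)`, OPENED summand-ready.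

HONEST DEPENDENCY (cell records, verbatim): «continuum YM on T⁴ ⇐ BetaPertH ∧ nine spine estimates (0/9 proved); BetaPertH ⇐ (D1) ∧ (D4) ∧
CAP+tail; G-an2-4 gates asym, D1 and NE2/3/4.»  HONEST FRAMING (cell contract, verbatim): «discharging `BetaPertH` makes Bałaban's UV stability
UNCONDITIONAL — a real constructive-QFT result; it is NOT the continuum limit and NOT the Clay problem.»  THIS MODULE DISCHARGES NOTHING of (K), of
(J1)'s row, of D1 or of the wall: [folklore] finite-sum ∕ exponential-sum bookkeeping on OUR objects ([S]-shape sockets and `Loc` certificates — NO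
`n`-uniformity is claimed: the socket constants carry `e^{cδ(d+1)n}`); prices NO row, asserts no currency and NO Ward law, proves NO clause of B12 Thm 2 ∕
Erice and NO estimate of Bałaban's.  No definition, no `def … : Prop`, nothing cited, 0 sorry.  0∕4 row-D1 binders; (K) NOT closed; (J1) = ONE OPEN ROW;
NOT D1, NEVER «G-an2-4 closed», NOT `BetaPertH`, NOT continuum, NOT Clay.

D1 formalisation swarm LEAF 03 (`b2b-balaban-beta-d1-formalise-leaf-03`, gen 29), 2026-08-23; over TT5 `SymCorrectorSockets`, TT6 `SymCorrectorRest`, TT8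
`SymCorrectorLiteralW`, an1's `SecondOrderResponse` and the OWNER's `D1BFx/ChartDefectWords(Literal)` BY NAME; no existing file touched.
-/

open scoped BigOperators
open Literature.MathematicalPhysics.QuantumFieldTheory
open Literature.MathematicalPhysics.QuantumFieldTheory.Balaban1983to89
open Literature.MathematicalPhysics.QuantumFieldTheory.Balaban1983to89.Beta
open B12Sec2to5 (l1 l1_nonneg)
open ExpKernelCalculus (MKer Decays BiLoc comp VertexFamily VertexFamily₂ l1_sub_symm l1_sub_triangle)
open OneStepResolventKernel (Fib LocStencil biLoc_mono)
open OneStepKernelFamily (KInvStep vertexOfK)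
open SecondOrderResponse (vertexOfM dM K2OfK mixOfK vertex2OfK LocStencilFM biLoc_recenter_right biLoc_vertexOfK_of_biLoc biLoc_vertexOfM_of_biLoc
  vertexFamily₂_mixOfK)
open BalabanCompositeJets (LocStencil₂)
open BalabanStepJets (locStencil_mono)
open BalabanStepW2 (M2Of locStencilFM_M2Of vertexFamily_mono')
open StepJetData (wilsonA)
open WilsonBiStencil (wilsonW₂)
open WilsonVertex2Sym (wsym22)
open AffineAveraging (Site box toSite)
open AveragingContours (blk)
open AveragingContoursRooted (ctrOff ctrOff_mem_box)
open Summit.QuantumFields.BalabanUV.Beta.TameKernelCalculus (Spr Loc trK Loc.add Spr.trK Spr.tame Loc.tame Spr.comp_loc comp_add_left_tame comp_add_right_tame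
  decays_of_le)
open Summit.QuantumFields.BalabanUV.Beta.AxialDressingRooted (coDressKBmAt one_le_of_neZero)
open Summit.QuantumFields.BalabanUV.Beta.SymmetrisedStepJets (SymTables)
open Summit.QuantumFields.BalabanUV.Beta.CombChartStepJets (GcombSh JsB12CombSh0 SpureCombOf decays_GcombSh locStencil_SpureCombOf)
open Summit.QuantumFields.BalabanUV.Beta.SpineRooted (T2RecOf T2RecOf_loc)
open Summit.QuantumFields.BalabanUV.Beta.KernelWardRelative (gaugeWt)
open Summit.QuantumFields.BalabanUV.Beta.SymCorrectorKernel (psiKS spr_psiKS)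
open Summit.QuantumFields.BalabanUV.Beta.SymCorrectorFace (faceWt faceWtSum bondNbhd slotPsiS slotPsiS_apply gaugeWt_eq abs_faceWt_le faceWtSum_nonneg card_bondNbhd_le
  l1_le_of_mem_bondNbhd)
open Summit.QuantumFields.BalabanUV.Beta.SymCorrectorSockets (locStencil_slotPsiS locStencil₂_slotPsiS₂)
open Summit.QuantumFields.BalabanUV.Beta.SymCorrectorRest (loc_inner)
open Summit.QuantumFields.BalabanUV.Beta.SymCorrectorLiteralW (loc_dM_of_spr JsB12CombSh0_W_zero_eq_transported)
open Summit.QuantumFields.BalabanUV.Beta.D1BFx.ChartDefectWords (loc_vertex2OfK_of_spr)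
open Summit.QuantumFields.BalabanUV.Beta.D1BFx.ChartDefectWordsLiteral (spr_G₀bm)

noncomputable section

namespace Summit.QuantumFields.BalabanUV.Beta.SymCorrectorLiteralLoc

variable {d : ℕ}

/-! ## §1 The [S]-shape socket for field–multiplier tables -/

section FM

variable {n : ℕ} (hn : 0 < n) (r : Fin (d + 1) → ℕ)
  {M₂ : Fin (d + 1) → Site (d + 1) → Fin (d + 1) → Site (d + 1) → MKer (d + 1) (Fib d)} {C δ : ℝ}
include hn

/-- [folklore] **TRANSPORT KEEPS `LocStencilFM`**: `LocStencilFM n M₂ C δ ⟹ LocStencilFM n (slotPsiS r n M₂) (C·(1 + faceWtSum·(d+1)·2n^{d+1}·e^{3δ(d+1)n})) δ`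
(the face members `M₂ κ u ρ w` of the block of `x` are re-centred from `u` to `x`, `|u − x|₁ ≤ (d+1)n`, in the three exponentials — TT5's outer pair socket with the
coarse point `n•w` in place of the second fine bond). -/
theorem locStencilFM_slotPsiS (hM₂ : LocStencilFM n M₂ C δ) (hδ : 0 ≤ δ) :
    LocStencilFM n (slotPsiS r n M₂) (C * (1 + faceWtSum r n * (((d + 1 : ℕ) : ℝ) * (2 * (n : ℝ) ^ (d + 1))) * Real.exp (δ * (3 * (((d + 1 : ℕ) : ℝ) * n))))) δ := by
  classical
  intro α x ρ w p q a b
  have hC : 0 ≤ C := hM₂.nonneg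
  set E : ℝ := Real.exp (-δ * l1 (x - (n : ℤ) • w)) * Real.exp (-δ * (l1 (p - x) + l1 (q - x))) with hE
  set M : ℝ := Real.exp (δ * (3 * (((d + 1 : ℕ) : ℝ) * n))) with hM
  have hE0 : 0 ≤ E := by positivity
  -- a face member re-centred at `x`
  have hmem : ∀ κ : Fin (d + 1), ∀ u ∈ bondNbhd n (blk n x) κ, |M₂ κ u ρ w p q a b| ≤ C * M * E := by
    intro κ u hu
    have hl := l1_le_of_mem_bondNbhd hn hu
    have t1 : l1 (x - (n : ℤ) • w) ≤ l1 (x - u) + l1 (u - (n : ℤ) • w) := l1_sub_triangle x u ((n : ℤ) • w)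
    have s1 : l1 (x - u) = l1 (u - x) := l1_sub_symm x u
    have t2 : l1 (p - x) ≤ l1 (p - u) + l1 (u - x) := l1_sub_triangle p u x
    have t3 : l1 (q - x) ≤ l1 (q - u) + l1 (u - x) := l1_sub_triangle q u x
    rw [s1] at t1
    refine (hM₂ κ u ρ w p q a b).trans ?_
    rw [hE, hM, mul_assoc, mul_assoc, ← Real.exp_add, ← Real.exp_add, ← Real.exp_add]
    exact mul_le_mul_of_nonneg_left (Real.exp_le_exp.2 (by nlinarith)) hC
  -- the face sum
  have hface : |(∑ κ : Fin (d + 1), ∑ u ∈ bondNbhd n (blk n x) κ, gaugeWt n (blk n x) κ u • M₂ κ u) ρ w p q a b|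
      ≤ ((d + 1 : ℕ) : ℝ) * (2 * (n : ℝ) ^ (d + 1)) * (C * M * E) := by
    simp only [Finset.sum_apply, Pi.smul_apply, smul_eq_mul]
    refine (Finset.abs_sum_le_sum_abs _ _).trans ?_
    have hin : ∀ κ : Fin (d + 1), |∑ u ∈ bondNbhd n (blk n x) κ, gaugeWt n (blk n x) κ u * M₂ κ u ρ w p q a b| ≤ (2 * (n : ℝ) ^ (d + 1)) * (C * M * E) := by
      intro κ
      refine (Finset.abs_sum_le_sum_abs _ _).trans ?_
      calc ∑ u ∈ bondNbhd n (blk n x) κ, |gaugeWt n (blk n x) κ u * M₂ κ u ρ w p q a b| ≤ ∑ _u ∈ bondNbhd n (blk n x) κ, C * M * E :=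
            Finset.sum_le_sum fun u hu => by
              rw [abs_mul]
              have hg : |gaugeWt n (blk n x) κ u| ≤ 1 := by rw [gaugeWt_eq]; split_ifs <;> norm_num
              calc |gaugeWt n (blk n x) κ u| * |M₂ κ u ρ w p q a b| ≤ 1 * (C * M * E) := mul_le_mul hg (hmem κ u hu) (abs_nonneg _) zero_le_one
                _ = C * M * E := one_mul _
        _ = (bondNbhd n (blk n x) κ).card * (C * M * E) := by rw [Finset.sum_const, nsmul_eq_mul]
        _ ≤ (2 * (n : ℝ) ^ (d + 1)) * (C * M * E) := mul_le_mul_of_nonneg_right (card_bondNbhd_le n _ κ) (by positivity)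
    calc ∑ κ : Fin (d + 1), |∑ u ∈ bondNbhd n (blk n x) κ, gaugeWt n (blk n x) κ u * M₂ κ u ρ w p q a b| ≤ ∑ _κ : Fin (d + 1), (2 * (n : ℝ) ^ (d + 1)) * (C * M * E) :=
          Finset.sum_le_sum fun κ _ => hin κ
      _ = ((d + 1 : ℕ) : ℝ) * (2 * (n : ℝ) ^ (d + 1)) * (C * M * E) := by rw [Finset.sum_const, Finset.card_univ, Fintype.card_fin, nsmul_eq_mul]; ring
  -- the raw member at `x` itself
  have h1 : |M₂ α x ρ w p q a b| ≤ C * E := by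
    have h := hM₂ α x ρ w p q a b; rwa [hE, ← mul_assoc]
  rw [slotPsiS_apply, Pi.add_apply, Pi.add_apply, Pi.add_apply, Pi.add_apply, Pi.add_apply, Pi.add_apply, Pi.smul_apply, Pi.smul_apply, Pi.smul_apply,
    Pi.smul_apply, Pi.smul_apply, Pi.smul_apply, smul_eq_mul]
  refine (abs_add_le _ _).trans ?_
  rw [abs_mul]
  have h2 := mul_le_mul (abs_faceWt_le hn r α x) hface (abs_nonneg _) (faceWtSum_nonneg r n)
  calc |M₂ α x ρ w p q a b| + |faceWt r n α x| * |(∑ κ : Fin (d + 1), ∑ u ∈ bondNbhd n (blk n x) κ, gaugeWt n (blk n x) κ u • M₂ κ u) ρ w p q a b|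
      ≤ C * E + faceWtSum r n * (((d + 1 : ℕ) : ℝ) * (2 * (n : ℝ) ^ (d + 1)) * (C * M * E)) := add_le_add h1 h2
    _ = C * (1 + faceWtSum r n * (((d + 1 : ℕ) : ℝ) * (2 * (n : ℝ) ^ (d + 1))) * M) * E := by ring
    _ = C * (1 + faceWtSum r n * (((d + 1 : ℕ) : ℝ) * (2 * (n : ℝ) ^ (d + 1))) * M) * Real.exp (-δ * l1 (x - (n : ℤ) • w))
          * Real.exp (-δ * (l1 (p - x) + l1 (q - x))) := by
        rw [hE]; ring

end FM

/-! ## §2 Generic `Loc` certificates: second-order vertex families, `dM` of a localised kernel, the mixed bi-vertex -/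

section GenericLoc

variable {n : ℕ}

/-- [folklore] A member of a second-order vertex family is a localised kernel. -/
theorem loc_of_vertexFamily₂ {W : Fin (d + 1) → Site (d + 1) → Fin (d + 1) → Site (d + 1) → MKer (d + 1) (Fib d)} {C δ : ℝ} (hW : VertexFamily₂ W n C δ)
    (hδ : 0 < δ) (μ : Fin (d + 1)) (y : Site (d + 1)) (ν : Fin (d + 1)) (y' : Site (d + 1)) : Loc (W μ y ν y') :=
  ⟨_, _, _, _, hδ, hW μ y ν y'⟩

/-- [folklore] **`dM X n S M μ y` OF A LOCALISED KERNEL `X` IS LOCALISED** (localised field tables, coarse-localised multiplier tables): re-centre the second leg of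
`X` onto the first (`biLoc_recenter_right`), harmonise the rates, and add an1's `biLoc_vertexOfK_of_biLoc` and `biLoc_vertexOfM_of_biLoc`. -/
theorem loc_dM_of_loc [NeZero n] {X : MKer (d + 1) (Fib d)} (hX : Loc X) {S : Fin (d + 1) → Site (d + 1) → MKer (d + 1) (Fib d)} {Cs δs : ℝ}
    (hS : LocStencil S Cs δs) (hδs : 0 < δs) {M : Fin (d + 1) → Site (d + 1) → MKer (d + 1) (Fib d)} {CM δM : ℝ} (hM : VertexFamily M n CM δM)
    (hδM : 0 < δM) (μ : Fin (d + 1)) (y : Site (d + 1)) : Loc (dM X n S M μ y) := by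
  obtain ⟨p, q, C, δ, hδ, hB⟩ := hX
  have hC : 0 ≤ C := hB.nonneg (Sum.inl 0)
  have hCs : 0 ≤ Cs := (hS 0 0).nonneg (Sum.inl 0)
  have hCM : 0 ≤ CM := (hM 0 0).nonneg (Sum.inl 0)
  have hm : 0 < min δ (min δs δM) := lt_min hδ (lt_min hδs hδM)
  have hB' : BiLoc X p q ((C * Real.exp (min δ (min δs δM) * l1 (p - q))) * Real.exp (-(min δ (min δs δM)) * l1 (p - q))) (min δ (min δs δM)) := by
    rw [mul_assoc, ← Real.exp_add, show min δ (min δs δM) * l1 (p - q) + -(min δ (min δs δM)) * l1 (p - q) = 0 by ring, Real.exp_zero, mul_one]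
    exact biLoc_mono hB hC (min_le_left _ _)
  have hBp : BiLoc X p p (C * Real.exp (min δ (min δs δM) * l1 (p - q))) (min δ (min δs δM)) := biLoc_recenter_right hB' (by positivity) hm.le le_rfl
  have hS' : LocStencil S Cs (min δ (min δs δM)) := locStencil_mono hS hCs ((min_le_right _ _).trans (min_le_left _ _))
  have hM' : VertexFamily M n CM (min δ (min δs δM)) := vertexFamily_mono' hM hCM ((min_le_right _ _).trans (min_le_right _ _))
  have h := KernelWard.biLoc_add (biLoc_vertexOfK_of_biLoc (N := n) hBp hS' hm μ y) (biLoc_vertexOfM_of_biLoc (N := n) hBp hM' hm μ y)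
  exact ⟨p, p, _, _, half_pos hm, h⟩

/-- [folklore] **THE MIXED BI-VERTEX OF A SPREAD KERNEL ON A LOCAL FIELD–MULTIPLIER TABLE IS LOCALISED** (an1's `vertexFamily₂_mixOfK` at the common rate). -/
theorem loc_mixOfK_of_spr [NeZero n] {K : MKer (d + 1) (Fib d)} (hK : Spr K)
    {M₂ : Fin (d + 1) → Site (d + 1) → Fin (d + 1) → Site (d + 1) → MKer (d + 1) (Fib d)} {C₂ δ₂ : ℝ} (hM₂ : LocStencilFM n M₂ C₂ δ₂) (hδ₂ : 0 < δ₂)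
    (μ : Fin (d + 1)) (y : Site (d + 1)) (ν : Fin (d + 1)) (y' : Site (d + 1)) : Loc (mixOfK K n M₂ μ y ν y') := by
  obtain ⟨C, δ, hδ, hKd⟩ := hK
  have hm : 0 < min δ δ₂ := lt_min hδ hδ₂
  have hK' : Decays K |C| (min δ δ₂) := decays_of_le hKd (min_le_left _ _)
  have hM₂' : LocStencilFM n M₂ C₂ (min δ δ₂) := hM₂.mono (min_le_right _ _)
  have h := vertexFamily₂_mixOfK (N := n) hK' (abs_nonneg C) hM₂' hm
  exact ⟨_, _, _, _, by positivity, h μ y ν y'⟩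

/-- [folklore] **LEG-DRESSING DISTRIBUTES OVER A SYMMETRISED SUM OF LOCALISED KERNELS**: `Pᵀ∘(½•(A + B))∘P = ½•(Pᵀ∘A∘P + Pᵀ∘B∘P)` (spread `P`; every factor tame —
`KernelReflection.comp_smul_left/right`, `TameKernelCalculus.comp_add_left/right_tame`). -/
theorem legDress_half_add {P A B : MKer (d + 1) (Fib d)} (hP : Spr P) (hA : Loc A) (hB : Loc B) :
    comp (comp (trK P) ((1 / 2 : ℝ) • (A + B))) P = (1 / 2 : ℝ) • (comp (comp (trK P) A) P + comp (comp (trK P) B) P) := by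
  rw [KernelReflection.comp_smul_right, KernelReflection.comp_smul_left, comp_add_right_tame hP.trK.tame hA.tame hB.tame,
    comp_add_left_tame (hP.trK.comp_loc hA).tame (hP.trK.comp_loc hB).tame hP.tame]

end GenericLoc

/-! ## §3 The four transported words of a spread kernel are localised -/

section Transported

variable {n : ℕ} (hn : 0 < n) {r : Fin (d + 1) → ℕ} (hr : r ∈ box (d + 1) n) {K : MKer (d + 1) (Fib d)} (hK : Spr K)
include hn hK

/-- [folklore] **THE PAIR WORD**: `vertex2OfK K n (slot∘slot S₂) μ y ν y′` is localised (TT5 `locStencil₂_slotPsiS₂` + the OWNER's `loc_vertex2OfK_of_spr`). -/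
theorem loc_vertex2OfK_slot₂ {S₂ : Fin (d + 1) → Site (d + 1) → Fin (d + 1) → Site (d + 1) → MKer (d + 1) (Fib d)} {C₂ δ₂ : ℝ} (hS₂ : LocStencil₂ S₂ C₂ δ₂)
    (hδ₂ : 0 < δ₂) (μ : Fin (d + 1)) (y : Site (d + 1)) (ν : Fin (d + 1)) (y' : Site (d + 1)) :
    Loc (vertex2OfK K n (fun α x => slotPsiS r n (slotPsiS r n S₂ α x)) μ y ν y') :=
  loc_vertex2OfK_of_spr hK (locStencil₂_slotPsiS₂ hn r hS₂ hδ₂.le) (locStencil₂_slotPsiS₂ hn r hS₂ hδ₂.le).nonneg hδ₂ μ y ν y'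

/-- [folklore] **THE MIXED WORDS**: `mixOfK K n (slot M₂) μ y ν y′` is localised (both bond orders: swap the arguments) — `locStencilFM_slotPsiS` + `loc_mixOfK_of_spr`. -/
theorem loc_mixOfK_slot {M₂ : Fin (d + 1) → Site (d + 1) → Fin (d + 1) → Site (d + 1) → MKer (d + 1) (Fib d)} {C₂ δ₂ : ℝ} (hM₂ : LocStencilFM n M₂ C₂ δ₂)
    (hδ₂ : 0 < δ₂) (μ : Fin (d + 1)) (y : Site (d + 1)) (ν : Fin (d + 1)) (y' : Site (d + 1)) : Loc (mixOfK K n (slotPsiS r n M₂) μ y ν y') := by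
  haveI : NeZero n := ⟨hn.ne'⟩
  exact loc_mixOfK_of_spr hK (locStencilFM_slotPsiS hn r hM₂ hδ₂.le) hδ₂ μ y ν y'

include hr

/-- [folklore] **THE `dM ∘ K2` WORD**: `dM (−(K ∘ (Ψ̂ᵀ ∘ dM K n (slot S) M ν y′ ∘ Ψ̂) ∘ K)) n (slot S) M μ y` is localised (TT5 `locStencil_slotPsiS`, TT8 `loc_dM_of_spr`,
TT6 `loc_inner`, `loc_dM_of_loc`). -/
theorem loc_resp_slot {S : Fin (d + 1) → Site (d + 1) → MKer (d + 1) (Fib d)} {Cs δs : ℝ} (hS : LocStencil S Cs δs) (hδs : 0 < δs)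
    {M : Fin (d + 1) → Site (d + 1) → MKer (d + 1) (Fib d)} {CM δM : ℝ} (hM : VertexFamily M n CM δM) (hδM : 0 < δM)
    (μ : Fin (d + 1)) (y : Site (d + 1)) (ν : Fin (d + 1)) (y' : Site (d + 1)) :
    Loc (dM (-(comp (comp K (comp (comp (trK (psiKS r n)) (dM K n (slotPsiS r n S) M ν y')) (psiKS r n))) K)) n (slotPsiS r n S) M μ y) := by
  haveI : NeZero n := ⟨hn.ne'⟩
  have hS' := locStencil_slotPsiS hn r hS hδs.le
  exact loc_dM_of_loc (loc_inner hn hr hK (loc_dM_of_spr hK hS' hδs hM hδM ν y')) hS' hδs hM hδM μ y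

/-- [folklore] **THE TRANSPORTED SECOND-ORDER FAMILY IS LOCALISED, MEMBER BY MEMBER**: the right-hand side `E μ y ν y′` of TT8 `W2OfK_conj_psiKS'` (sum of the four words). -/
theorem loc_transportedW {S : Fin (d + 1) → Site (d + 1) → MKer (d + 1) (Fib d)} {Cs δs : ℝ} (hS : LocStencil S Cs δs) (hδs : 0 < δs)
    {M : Fin (d + 1) → Site (d + 1) → MKer (d + 1) (Fib d)} {CM δM : ℝ} (hM : VertexFamily M n CM δM) (hδM : 0 < δM)
    {S₂ : Fin (d + 1) → Site (d + 1) → Fin (d + 1) → Site (d + 1) → MKer (d + 1) (Fib d)} {C₂ δ₂ : ℝ} (hS₂ : LocStencil₂ S₂ C₂ δ₂) (hδ₂ : 0 < δ₂)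
    {M₂ : Fin (d + 1) → Site (d + 1) → Fin (d + 1) → Site (d + 1) → MKer (d + 1) (Fib d)} {CF δF : ℝ} (hM₂ : LocStencilFM n M₂ CF δF) (hδF : 0 < δF)
    (μ : Fin (d + 1)) (y : Site (d + 1)) (ν : Fin (d + 1)) (y' : Site (d + 1)) :
    Loc (vertex2OfK K n (fun α x => slotPsiS r n (slotPsiS r n S₂ α x)) μ y ν y'
        + mixOfK K n (slotPsiS r n M₂) μ y ν y' + mixOfK K n (slotPsiS r n M₂) ν y' μ y
        + dM (-(comp (comp K (comp (comp (trK (psiKS r n)) (dM K n (slotPsiS r n S) M ν y')) (psiKS r n))) K)) n (slotPsiS r n S) M μ y) :=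
  (((loc_vertex2OfK_slot₂ hn hK hS₂ hδ₂ μ y ν y').add (loc_mixOfK_slot hn hK hM₂ hδF μ y ν y')).add (loc_mixOfK_slot hn hK hM₂ hδF ν y' μ y)).add
    (loc_resp_slot hn hr hK hS hδs hM hδM μ y ν y')

end Transported

/-! ## §4 d + 1 = 4: the words of the literal's transported W slot are localised -/

section Literal

variable (n : ℕ) [NeZero n] (N : ℕ) (tabs : SymTables 3 n) (cB : ℝ)

/-- [folklore] The level-0 pure first-order table of the literal is a local stencil family (`locStencil_SpureCombOf … 0` at `cΛ := 0` — the level-0 member is `Λ`-free; displayed form). -/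
theorem locStencil_literalS : ∃ Cs δs : ℝ, 0 < δs ∧
    LocStencil (fun κ (u : Site (3 + 1)) => ((n : ℝ) ^ 4) • wilsonA 3 κ u + (-((n : ℝ) ^ 8 / 2)) • tabs.V κ u) Cs δs :=
  locStencil_SpureCombOf (d := 3) tabs ((n : ℝ) ^ 4) (-((n : ℝ) ^ 8 / 2)) 0 0

/-- [folklore] The level-0 pair table of the literal is a local fine bi-stencil family (`RecursiveWSlot.T2RecOf_loc … 0`, displayed form). -/
theorem locStencil₂_literalS₂ : ∃ C₂ δ₂ : ℝ, 0 < δ₂ ∧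
    LocStencil₂ (fun κ (u : Site (3 + 1)) κ' u' => ((n : ℝ) ^ 8) • wilsonW₂ 3 ((8 * (N : ℝ) ^ 2)⁻¹ • wsym22 N) κ u κ' u' + cB • tabs.vh₂S κ u κ' u') C₂ δ₂ :=
  T2RecOf_loc ((n : ℝ) ^ 8) cB ((8 * (N : ℝ) ^ 2)⁻¹ • wsym22 N) tabs.vh₂S tabs.mixFF (one_le_of_neZero n) (decays_GcombSh (d := 3) n)
    (locStencil_SpureCombOf (d := 3) tabs ((n : ℝ) ^ 4) (-((n : ℝ) ^ 8 / 2)) 0) tabs.hM tabs.hB tabs.hmix 0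

omit [NeZero n] in
/-- [folklore] The level-0 weighted mixed table of the literal is a local field–multiplier family (`locStencilFM_M2Of tabs.hmix 0`). -/
theorem locStencilFM_literalM₂ : ∃ CF δF : ℝ, 0 < δF ∧ LocStencilFM n (M2Of 3 n tabs.mixFF 0) CF δF := by
  obtain ⟨CF, δF, hδF, hmix⟩ := tabs.hmix
  exact ⟨_, δF, hδF, locStencilFM_M2Of hmix 0⟩

/-- [folklore] **THE PAIR WORD OF THE LITERAL IS LOCALISED**: `vertex2OfK G₀ n (slot∘slot S₂⁰) μ y ν y′`. -/
theorem loc_literalW_pair (μ : Fin 4) (y : Fin 4 → ℤ) (ν : Fin 4) (y' : Fin 4 → ℤ) :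
    Loc (vertex2OfK (coDressKBmAt (toSite (ctrOff 4 n)) n (KInvStep (d := 3) n 0)) n
      (fun α x => slotPsiS (ctrOff 4 n) n (slotPsiS (ctrOff 4 n) n
        (fun κ u κ' u' => ((n : ℝ) ^ 8) • wilsonW₂ 3 ((8 * (N : ℝ) ^ 2)⁻¹ • wsym22 N) κ u κ' u' + cB • tabs.vh₂S κ u κ' u') α x)) μ y ν y') := by
  have hn : 0 < n := Nat.pos_of_ne_zero (NeZero.ne n)
  obtain ⟨C₂, δ₂, hδ₂, hS₂⟩ := locStencil₂_literalS₂ n N tabs cB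
  exact loc_vertex2OfK_slot₂ hn (spr_G₀bm n) hS₂ hδ₂ μ y ν y'

/-- [folklore] **THE MIXED WORDS OF THE LITERAL ARE LOCALISED**: `mixOfK G₀ n (slot M₂⁰) μ y ν y′` (either bond order). -/
theorem loc_literalW_mix (μ : Fin 4) (y : Fin 4 → ℤ) (ν : Fin 4) (y' : Fin 4 → ℤ) :
    Loc (mixOfK (coDressKBmAt (toSite (ctrOff 4 n)) n (KInvStep (d := 3) n 0)) n (slotPsiS (ctrOff 4 n) n (M2Of 3 n tabs.mixFF 0)) μ y ν y') := by
  have hn : 0 < n := Nat.pos_of_ne_zero (NeZero.ne n)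
  obtain ⟨CF, δF, hδF, hM₂⟩ := locStencilFM_literalM₂ n tabs
  exact loc_mixOfK_slot hn (spr_G₀bm n) hM₂ hδF μ y ν y'

/-- [folklore] **THE `dM ∘ K2` WORD OF THE LITERAL IS LOCALISED**: `dM (−(G₀ ∘ (Ψ̂ᵀ ∘ dM G₀ n (slot S♭) (tabs.M 0) ν y′ ∘ Ψ̂) ∘ G₀)) n (slot S♭) (tabs.M 0) μ y`. -/
theorem loc_literalW_resp (μ : Fin 4) (y : Fin 4 → ℤ) (ν : Fin 4) (y' : Fin 4 → ℤ) :
    Loc (dM (-(comp (comp (coDressKBmAt (toSite (ctrOff 4 n)) n (KInvStep (d := 3) n 0))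
          (comp (comp (trK (psiKS (ctrOff 4 n) n))
            (dM (coDressKBmAt (toSite (ctrOff 4 n)) n (KInvStep (d := 3) n 0)) n
              (slotPsiS (ctrOff 4 n) n (fun κ u => ((n : ℝ) ^ 4) • wilsonA 3 κ u + (-((n : ℝ) ^ 8 / 2)) • tabs.V κ u)) (tabs.M 0) ν y'))
            (psiKS (ctrOff 4 n) n)))
          (coDressKBmAt (toSite (ctrOff 4 n)) n (KInvStep (d := 3) n 0))))
        n (slotPsiS (ctrOff 4 n) n (fun κ u => ((n : ℝ) ^ 4) • wilsonA 3 κ u + (-((n : ℝ) ^ 8 / 2)) • tabs.V κ u)) (tabs.M 0) μ y) := by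
  have hn : 0 < n := Nat.pos_of_ne_zero (NeZero.ne n)
  obtain ⟨Cs, δs, hδs, hS⟩ := locStencil_literalS n tabs
  obtain ⟨CM, δM, hδM, hM⟩ := tabs.hM 0
  exact loc_resp_slot hn (ctrOff_mem_box hn) (spr_G₀bm n) hS hδs hM hδM μ y ν y'

/-- [folklore] **THE LITERAL's TRANSPORTED SECOND-ORDER FAMILY `E μ y ν y′` OF TT8 `JsB12CombSh0_W_zero_eq_transported` IS LOCALISED** (so `W⁰ μ y ν y′ = ½•(E μ y ν y′ + E ν y′ μ y)`
splits under `tadpole` ∕ `hessKer` by `TameKernelCalculus.tadpole_add` after leg-dressing with `ChartDefectWords.loc_legDress`). -/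
theorem loc_literalW_transported (μ : Fin 4) (y : Fin 4 → ℤ) (ν : Fin 4) (y' : Fin 4 → ℤ) :
    Loc (vertex2OfK (coDressKBmAt (toSite (ctrOff 4 n)) n (KInvStep (d := 3) n 0)) n
            (fun α x => slotPsiS (ctrOff 4 n) n (slotPsiS (ctrOff 4 n) n
              (fun κ u κ' u' => ((n : ℝ) ^ 8) • wilsonW₂ 3 ((8 * (N : ℝ) ^ 2)⁻¹ • wsym22 N) κ u κ' u' + cB • tabs.vh₂S κ u κ' u') α x)) μ y ν y'
          + mixOfK (coDressKBmAt (toSite (ctrOff 4 n)) n (KInvStep (d := 3) n 0)) n (slotPsiS (ctrOff 4 n) n (M2Of 3 n tabs.mixFF 0)) μ y ν y'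
          + mixOfK (coDressKBmAt (toSite (ctrOff 4 n)) n (KInvStep (d := 3) n 0)) n (slotPsiS (ctrOff 4 n) n (M2Of 3 n tabs.mixFF 0)) ν y' μ y
          + dM (-(comp (comp (coDressKBmAt (toSite (ctrOff 4 n)) n (KInvStep (d := 3) n 0))
                (comp (comp (trK (psiKS (ctrOff 4 n) n))
                  (dM (coDressKBmAt (toSite (ctrOff 4 n)) n (KInvStep (d := 3) n 0)) n
                    (slotPsiS (ctrOff 4 n) n (fun κ u => ((n : ℝ) ^ 4) • wilsonA 3 κ u + (-((n : ℝ) ^ 8 / 2)) • tabs.V κ u)) (tabs.M 0) ν y'))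
                  (psiKS (ctrOff 4 n) n)))
                (coDressKBmAt (toSite (ctrOff 4 n)) n (KInvStep (d := 3) n 0))))
              n (slotPsiS (ctrOff 4 n) n (fun κ u => ((n : ℝ) ^ 4) • wilsonA 3 κ u + (-((n : ℝ) ^ 8 / 2)) • tabs.V κ u)) (tabs.M 0) μ y) := by
  have hn : 0 < n := Nat.pos_of_ne_zero (NeZero.ne n)
  obtain ⟨Cs, δs, hδs, hS⟩ := locStencil_literalS n tabs
  obtain ⟨CM, δM, hδM, hM⟩ := tabs.hM 0
  obtain ⟨C₂, δ₂, hδ₂, hS₂⟩ := locStencil₂_literalS₂ n N tabs cB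
  obtain ⟨CF, δF, hδF, hM₂⟩ := locStencilFM_literalM₂ n tabs
  exact loc_transportedW hn (ctrOff_mem_box hn) (spr_G₀bm n) hS hδs hM hδM hS₂ hδ₂ hM₂ hδF μ y ν y'

/-- [folklore] **THE LITERAL's LEG-DRESSED W WORD, OPENED**: for the whole W slot `W⁰ := (JsB12CombSh0 hodd N tabs cΛ cB 0).W` of `D1BFx/ChartDefectWordsLiteral`,
`Ψ̂ᵀ ∘ W⁰ μ y ν y′ ∘ Ψ̂ = ½ • (Ψ̂ᵀ ∘ E μ y ν y′ ∘ Ψ̂ + Ψ̂ᵀ ∘ E ν y′ μ y ∘ Ψ̂)` with `E` the transported family of TT8 `JsB12CombSh0_W_zero_eq_transported` (that identity,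
`legDress_half_add`, `loc_literalW_transported` in both bond orders) — the numerator of the (T4) tadpole word `tadpole G₀ (Ψ̂ᵀ∘W⁰ μ 0 ν z∘Ψ̂ − W μ 0 ν z)` summand-ready. -/
theorem legDress_literalW (hodd : Odd n) (cΛ : ℝ) (μ : Fin 4) (y : Fin 4 → ℤ) (ν : Fin 4) (y' : Fin 4 → ℤ) :
    comp (comp (trK (psiKS (ctrOff 4 n) n)) ((JsB12CombSh0 hodd N tabs cΛ cB 0).W μ y ν y')) (psiKS (ctrOff 4 n) n)
      = (1 / 2 : ℝ) •
        (comp (comp (trK (psiKS (ctrOff 4 n) n))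
            (vertex2OfK (coDressKBmAt (toSite (ctrOff 4 n)) n (KInvStep (d := 3) n 0)) n
                (fun α x => slotPsiS (ctrOff 4 n) n (slotPsiS (ctrOff 4 n) n
                  (fun κ u κ' u' => ((n : ℝ) ^ 8) • wilsonW₂ 3 ((8 * (N : ℝ) ^ 2)⁻¹ • wsym22 N) κ u κ' u' + cB • tabs.vh₂S κ u κ' u') α x)) μ y ν y'
              + mixOfK (coDressKBmAt (toSite (ctrOff 4 n)) n (KInvStep (d := 3) n 0)) n (slotPsiS (ctrOff 4 n) n (M2Of 3 n tabs.mixFF 0)) μ y ν y'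
              + mixOfK (coDressKBmAt (toSite (ctrOff 4 n)) n (KInvStep (d := 3) n 0)) n (slotPsiS (ctrOff 4 n) n (M2Of 3 n tabs.mixFF 0)) ν y' μ y
              + dM (-(comp (comp (coDressKBmAt (toSite (ctrOff 4 n)) n (KInvStep (d := 3) n 0))
                    (comp (comp (trK (psiKS (ctrOff 4 n) n))
                      (dM (coDressKBmAt (toSite (ctrOff 4 n)) n (KInvStep (d := 3) n 0)) n
                        (slotPsiS (ctrOff 4 n) n (fun κ u => ((n : ℝ) ^ 4) • wilsonA 3 κ u + (-((n : ℝ) ^ 8 / 2)) • tabs.V κ u)) (tabs.M 0) ν y'))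
                      (psiKS (ctrOff 4 n) n)))
                    (coDressKBmAt (toSite (ctrOff 4 n)) n (KInvStep (d := 3) n 0))))
                  n (slotPsiS (ctrOff 4 n) n (fun κ u => ((n : ℝ) ^ 4) • wilsonA 3 κ u + (-((n : ℝ) ^ 8 / 2)) • tabs.V κ u)) (tabs.M 0) μ y)) (psiKS (ctrOff 4 n) n)
          + comp (comp (trK (psiKS (ctrOff 4 n) n))
            (vertex2OfK (coDressKBmAt (toSite (ctrOff 4 n)) n (KInvStep (d := 3) n 0)) n
                (fun α x => slotPsiS (ctrOff 4 n) n (slotPsiS (ctrOff 4 n) n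
                  (fun κ u κ' u' => ((n : ℝ) ^ 8) • wilsonW₂ 3 ((8 * (N : ℝ) ^ 2)⁻¹ • wsym22 N) κ u κ' u' + cB • tabs.vh₂S κ u κ' u') α x)) ν y' μ y
              + mixOfK (coDressKBmAt (toSite (ctrOff 4 n)) n (KInvStep (d := 3) n 0)) n (slotPsiS (ctrOff 4 n) n (M2Of 3 n tabs.mixFF 0)) ν y' μ y
              + mixOfK (coDressKBmAt (toSite (ctrOff 4 n)) n (KInvStep (d := 3) n 0)) n (slotPsiS (ctrOff 4 n) n (M2Of 3 n tabs.mixFF 0)) μ y ν y'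
              + dM (-(comp (comp (coDressKBmAt (toSite (ctrOff 4 n)) n (KInvStep (d := 3) n 0))
                    (comp (comp (trK (psiKS (ctrOff 4 n) n))
                      (dM (coDressKBmAt (toSite (ctrOff 4 n)) n (KInvStep (d := 3) n 0)) n
                        (slotPsiS (ctrOff 4 n) n (fun κ u => ((n : ℝ) ^ 4) • wilsonA 3 κ u + (-((n : ℝ) ^ 8 / 2)) • tabs.V κ u)) (tabs.M 0) μ y))
                      (psiKS (ctrOff 4 n) n)))
                    (coDressKBmAt (toSite (ctrOff 4 n)) n (KInvStep (d := 3) n 0))))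
                  n (slotPsiS (ctrOff 4 n) n (fun κ u => ((n : ℝ) ^ 4) • wilsonA 3 κ u + (-((n : ℝ) ^ 8 / 2)) • tabs.V κ u)) (tabs.M 0) ν y')) (psiKS (ctrOff 4 n) n)) := by
  have hn : 0 < n := Nat.pos_of_ne_zero (NeZero.ne n)
  rw [JsB12CombSh0_W_zero_eq_transported]
  exact legDress_half_add (spr_psiKS hn (ctrOff_mem_box hn)) (loc_literalW_transported n N tabs cB μ y ν y') (loc_literalW_transported n N tabs cB ν y' μ y)

end Literal

end Summit.QuantumFields.BalabanUV.Beta.SymCorrectorLiteralLoc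

end
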